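import Mathlib
import HarnessLib
import Literature.MathematicalPhysics.QuantumLattice.SectorisedKernelNormRefinementFlatCount
import Summits.HubbardSuperconductivity.HubbardSuperconductivity.Theorems.KLProgrammeKLRegimeEngineNormsJumpResectorisationPrescribed
import Summits.HubbardSuperconductivity.HubbardSuperconductivity.Theorems.KLProgrammeH10TwoPointLimitKlAnisoLastLegCount

/-!
# Route `KLProgramme` — crux K3 ENGINE, item stmt-HubbardSuperconductivity-20437 `KLRegimeEngineV17F2`, stub (b) `stub_engine_step_norms`
# (clause (E1), blocked birth-level tower, `(Hμ)` re-sectorisation at a jump `k → J′`): THE RELATIVE COUNT WITH ONE DETERMINED LEG, discharged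

Cell gate-hubbard-kl, seat p4 (C5a sector-counting lead), g11.  The jump re-sectorisation lemmas of k3c2-p3 take the number of admissible fine label
tuples refining a coarse one as counting-lane HYPOTHESES: `R` of `EngineV8.hubbardSectorKernelNorm_klAniso_jump_le_of_relCount`, `R₁`/`R₂` (`hRoff`/`hRon`)
of `…_split` and of `EngineV8.hubbardSectorPrescribedSum_klAniso_jump_le_split` (fine labels prescribed on a leg set `E`).  So far the tree discharged them
only FLATLY (`EngineV8.card_relCount_prescribed_flat_klAniso_le`: `(27·2^{J′−k})^{(m+1)−|E|}`, one factor per free leg, no use of momentum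
conservation).  This file lands the first conservation gain, uniformly modulo `2πℤ²` (Benfatto–Giuliani–Mastropietro 2006 (2.83)/(2.89); E1-TOWER-BLOCKED
§10 (d) «on-class row `R₂(F,Δ) ≤ c^L 2^{Δ(L−F−1)}`», valid for EVERY coarse tuple, on or off the umklapp-corner class):

* **`card_relCount_prescribed_lastLeg_klAniso_le`** — in the KL regime (`FrameOK R U (nScales β) ν K`, `0 < c ≤ c₃(R)`, `0 < U ≤ U₀(R)`,
  `klBetaMin ≤ β ≤ e^{c/U²}`, `μ` in a window `[μ₁, μ₂] ⊂ (-4, 0)`), for `k ≤ J′`, every constraint set `A″ ⊆ bgmSectorSet L M (klAnisoFamily … J′) (m+1)`,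
  leg set `E` with prescribed labels `τ″|_E`, and coarse (`klAnisoFamily k`) label tuple `σ′`:
  `#{σ″ ∈ A″ : σ″|_E = τ″|_E, σ″ refines σ′ leg by leg} ≤ D · (27·2^{J′−k})^{(m+1) − |E| − 1}` — `D = D(window, m)` fixed BEFORE `R`, uniform in the
  frame, `β`, `U`, `c`, `L`, `M`, `k`, `J′`, `E`, `τ″`, `σ′`; ONE free leg is paid `D` instead of `27·2^{J′−k}` (its spin and charge are those of `σ′`, its
  sector is pinned by the other legs through `card_lastLeg_bgmSectorSet_klAniso_le_frameOK`);
* **`card_relCount_prescribed_lastLeg_klAniso_le_window`** — the same on the covariance window `klWindowC`.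

Generic layer: `Literature.….card_filter_prescribed_children_lastLeg_le`.  Everything is PROVED; no definitions; nothing about the model is asserted
beyond this count.  References: BGM 2006 §2.7 (2.71a), §2.8 (2.83), (2.88)–(2.90), App. A3 Lemma A3.1 [cite: BenfattoGiulianiMastropietro2006];
Mastropietro 2008 (14.67) [cite: Mastropietro2008]; HOME/prover-p4/COUNTING-NOTE-2.md (the corner class: why the second determined leg of
Lemma A3.1 is NOT uniform modulo `2πℤ²`, so that `(m+1) − |E| − 2` needs the split of `…_split`).
-/

noncomputable section

namespace Summit.HubbardSuperconductivity.HubbardSuperconductivity.Theorems.EngineV8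

set_option linter.dupNamespace false -- summit = problem name (single-conjunct summit), D-0017

open Classical
open Real Finset Literature.MathematicalPhysics.QuantumLattice Literature.Probability.LatticeModels GrassmannAlgebra
open Summit.HubbardSuperconductivity.HubbardSuperconductivity.Theorems.KLProgrammeLegKernels
open Summit.HubbardSuperconductivity.HubbardSuperconductivity.Theorems.KLRegimeSplit
open Summit.HubbardSuperconductivity.HubbardSuperconductivity.Theorems.TorusFourierL2
open Summit.HubbardSuperconductivity.HubbardSuperconductivity.Theorems.PerturbedFermiCurve

/-- **THE RELATIVE JUMP COUNT WITH PRESCRIBED LEGS AND ONE DETERMINED LEG, in the KL regime** (BGM 2006 (2.83)/(2.89)): for every level window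
`[μ₁, μ₂] ⊂ (-4, 0)` and number of legs `m + 1` there is `D > 0` (fixed before `R`), and for every `R` (`Gfr ≥ 0`) thresholds `c₃, U₀ > 0`, such that
for all `0 < c ≤ c₃`, `0 < U ≤ U₀`, `klBetaMin ≤ β ≤ e^{c/U²}`, `μ ∈ [μ₁, μ₂]`, every frame with `FrameOK R U (nScales β) ν K`, every torus `L ≥ 1`,
cutoff `M`, scales `k ≤ J′`, every `A″ ⊆ bgmSectorSet L M (klAnisoFamily L M β μ K klE0 J′) (m+1)`, leg set `E`, prescribed labels `τ″` and coarse
label tuple `σ′`: the number of `σ″ ∈ A″` with `σ″|_E = τ″|_E` overlapping `σ′` leg by leg (support overlap with the fat multiplier of index `k`, same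
spin and charge) is `≤ D · (27·2^{J′−k})^{(m+1) − |E| − 1}`. [cite: BenfattoGiulianiMastropietro2006, §2.8 (2.83), (2.88)-(2.90), App. A3] -/
theorem card_relCount_prescribed_lastLeg_klAniso_le :
    ∀ μ₁ μ₂ : ℝ, -4 < μ₁ → μ₁ ≤ μ₂ → μ₂ < 0 → ∀ m : ℕ, ∃ D : ℝ, 0 < D ∧ ∀ R : RenConsts, (∀ j, 0 ≤ R.Gfr j) →
      ∃ c₃ : ℝ, 0 < c₃ ∧ ∃ U₀ : ℝ, 0 < U₀ ∧
      ∀ c : ℝ, 0 < c → c ≤ c₃ → ∀ U : ℝ, 0 < U → U ≤ U₀ → ∀ β : ℝ, klBetaMin ≤ β → β ≤ Real.exp (c / U ^ 2) →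
      ∀ μ ∈ Set.Icc μ₁ μ₂, ∀ (ν : ℝ) (K : TrigPolyC4v), FrameOK R U (nScales β) ν K →
      ∀ (L M : ℕ) [NeZero L] (k J' : ℕ), k ≤ J' →
      ∀ A'' : Finset (Fin (m + 1) → SectorLeg (sectorCount J')), A'' ⊆ bgmSectorSet L M (klAnisoFamily L M β μ K klE0 J') (m + 1) →
      ∀ (E : Finset (Fin (m + 1))) (τ'' : Fin (m + 1) → SectorLeg (sectorCount J')) (σ' : Fin (m + 1) → SectorLeg (sectorCount k)),
      (((A''.filter fun σ'' => (∀ e ∈ E, σ'' e = τ'' e) ∧ ∀ i,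
        (∃ q : FreqMomentum L M, klAnisoFamily L M β μ K klE0 J' (σ'' i).1.1 q ≠ 0 ∧
          bgmFatMultiplier L M klE0 β (nambuXiCT L μ K) k (σ' i).1.1 q ≠ 0) ∧
        (σ' i).1.2 = (σ'' i).1.2 ∧ (σ' i).2 = (σ'' i).2).card : ℝ)) ≤
        D * ((27 * 2 ^ (J' - k) : ℕ) : ℝ) ^ ((m + 1) - E.card - 1) := by
  intro μ₁ μ₂ hμ₁ h12 hμ₂ m
  obtain ⟨D, hD, hreg⟩ := card_lastLeg_bgmSectorSet_klAniso_le_frameOK μ₁ μ₂ hμ₁ h12 hμ₂ m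
  refine ⟨D + 1, by positivity, fun R hR => ?_⟩
  obtain ⟨c₃, hc₃, U₀, hU₀, hcnt⟩ := hreg R hR
  refine ⟨c₃, hc₃, U₀, hU₀, ?_⟩
  intro c hc hcle U hU hUle β hβmin hβc μ hμ ν K hK L M _ k J' hkJ A'' hA'' E τ'' σ'
  have he : (0 : ℝ) < klE0 := by norm_num [klE0]
  have hlast := hcnt c hc hcle U hU hUle β hβmin hβc μ hμ ν K hK L M J'
  have hXpos : (0 : ℝ) < ((27 * 2 ^ (J' - k) : ℕ) : ℝ) ^ ((m + 1) - E.card - 1) := by positivity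
  have hX1 : (1 : ℝ) ≤ ((27 * 2 ^ (J' - k) : ℕ) : ℝ) ^ ((m + 1) - E.card - 1) :=
    one_le_pow₀ (by exact_mod_cast Nat.one_le_iff_ne_zero.2 (by positivity))
  by_cases hE : E = Finset.univ
  · -- everything prescribed: at most the one tuple `τ″`
    have h1 : (A''.filter fun σ'' => (∀ e ∈ E, σ'' e = τ'' e) ∧ ∀ i,
        (∃ q : FreqMomentum L M, klAnisoFamily L M β μ K klE0 J' (σ'' i).1.1 q ≠ 0 ∧
          bgmFatMultiplier L M klE0 β (nambuXiCT L μ K) k (σ' i).1.1 q ≠ 0) ∧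
        (σ' i).1.2 = (σ'' i).1.2 ∧ (σ' i).2 = (σ'' i).2).card ≤ 1 := by
      refine Finset.card_le_one.2 fun σ₁ h₁ σ₂ h₂ => ?_
      rw [Finset.mem_filter] at h₁ h₂
      funext e
      rw [h₁.2.1 e (hE ▸ Finset.mem_univ e), h₂.2.1 e (hE ▸ Finset.mem_univ e)]
    have h1r : (((A''.filter fun σ'' => (∀ e ∈ E, σ'' e = τ'' e) ∧ ∀ i,
        (∃ q : FreqMomentum L M, klAnisoFamily L M β μ K klE0 J' (σ'' i).1.1 q ≠ 0 ∧
          bgmFatMultiplier L M klE0 β (nambuXiCT L μ K) k (σ' i).1.1 q ≠ 0) ∧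
        (σ' i).1.2 = (σ'' i).1.2 ∧ (σ' i).2 = (σ'' i).2).card : ℝ)) ≤ 1 := by exact_mod_cast h1
    calc _ ≤ (1 : ℝ) := h1r
      _ ≤ (D + 1) * 1 := by linarith
      _ ≤ (D + 1) * ((27 * 2 ^ (J' - k) : ℕ) : ℝ) ^ ((m + 1) - E.card - 1) :=
          mul_le_mul_of_nonneg_left hX1 (by positivity)
  · -- a free leg `ℓ ∉ E` is determined by the others
    obtain ⟨ℓ, hℓ⟩ : ∃ ℓ : Fin (m + 1), ℓ ∉ E := by
      by_contra hne
      push Not at hne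
      exact hE (Finset.eq_univ_of_forall hne)
    -- children per coarse label (fine side of the thin × fat overlap count, same spin and charge)
    have hκ : ∀ ℓ' : SectorLeg (sectorCount k), ((univ.filter fun ℓ'' : SectorLeg (sectorCount J') =>
        (∃ q : FreqMomentum L M, klAnisoFamily L M β μ K klE0 J' ℓ''.1.1 q ≠ 0 ∧
          bgmFatMultiplier L M klE0 β (nambuXiCT L μ K) k ℓ'.1.1 q ≠ 0) ∧
        ℓ'.1.2 = ℓ''.1.2 ∧ ℓ'.2 = ℓ''.2).card) ≤ 27 * 2 ^ (J' - k) := by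
      intro ℓ'
      calc (univ.filter fun ℓ'' : SectorLeg (sectorCount J') =>
            (∃ q : FreqMomentum L M, klAnisoFamily L M β μ K klE0 J' ℓ''.1.1 q ≠ 0 ∧
              bgmFatMultiplier L M klE0 β (nambuXiCT L μ K) k ℓ'.1.1 q ≠ 0) ∧
            ℓ'.1.2 = ℓ''.1.2 ∧ ℓ'.2 = ℓ''.2).card
          ≤ ((univ : Finset (Fin (sectorCount J'))).filter (fun ω₁ : Fin (sectorCount J') =>
              ∃ q : FreqMomentum L M, klAnisoFamily L M β μ K klE0 J' ω₁ q ≠ 0 ∧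
                bgmFatMultiplier L M klE0 β (nambuXiCT L μ K) k ℓ'.1.1 q ≠ 0)).card := by
            refine Finset.card_le_card_of_injOn (fun ℓ'' : SectorLeg (sectorCount J') => ℓ''.1.1) (fun ℓ'' hℓ'' => ?_)
              (fun ℓ₁ h₁ ℓ₂ h₂ heq => ?_)
            · simp only [mem_coe, mem_filter, mem_univ, true_and] at hℓ'' ⊢
              exact hℓ''.1
            · simp only [mem_coe, mem_filter, mem_univ, true_and] at h₁ h₂
              exact Prod.ext (Prod.ext heq (h₁.2.1.symm.trans h₂.2.1)) (h₁.2.2.symm.trans h₂.2.2)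
        _ ≤ 27 * 2 ^ (J' - k) := card_overlap_klAniso_bgmFat_fine_le he β μ K hkJ _
    -- the last leg: spin and charge from `σ′ ℓ`, sector pinned by the other legs
    have hDceil : ∀ ρ : Fin (m + 1) → SectorLeg (sectorCount J'), ((univ.filter fun s'' : SectorLeg (sectorCount J') =>
        ((∃ q : FreqMomentum L M, klAnisoFamily L M β μ K klE0 J' s''.1.1 q ≠ 0 ∧
          bgmFatMultiplier L M klE0 β (nambuXiCT L μ K) k (σ' ℓ).1.1 q ≠ 0) ∧
        (σ' ℓ).1.2 = s''.1.2 ∧ (σ' ℓ).2 = s''.2) ∧ Function.update ρ ℓ s'' ∈ A'').card) ≤ ⌈D⌉₊ := by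
      intro ρ
      have hinj : ((univ.filter fun s'' : SectorLeg (sectorCount J') =>
          ((∃ q : FreqMomentum L M, klAnisoFamily L M β μ K klE0 J' s''.1.1 q ≠ 0 ∧
            bgmFatMultiplier L M klE0 β (nambuXiCT L μ K) k (σ' ℓ).1.1 q ≠ 0) ∧
          (σ' ℓ).1.2 = s''.1.2 ∧ (σ' ℓ).2 = s''.2) ∧ Function.update ρ ℓ s'' ∈ A'').card) ≤
          ((Finset.univ : Finset (Fin (sectorCount J'))).filter (fun ω : Fin (sectorCount J') =>
            Function.update ρ ℓ ((ω, (σ' ℓ).1.2), (σ' ℓ).2) ∈ bgmSectorSet L M (klAnisoFamily L M β μ K klE0 J') (m + 1))).card := by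
        refine Finset.card_le_card_of_injOn (fun s'' : SectorLeg (sectorCount J') => s''.1.1) (fun s'' hs'' => ?_)
          (fun s₁ h₁ s₂ h₂ heq => ?_)
        · simp only [mem_coe, mem_filter, mem_univ, true_and] at hs'' ⊢
          obtain ⟨⟨-, h2, h3⟩, hA⟩ := hs''
          have hs : s'' = ((s''.1.1, (σ' ℓ).1.2), (σ' ℓ).2) := by rw [h2, h3]
          rw [← hs]
          exact hA'' hA
        · simp only [mem_coe, mem_filter, mem_univ, true_and] at h₁ h₂
          exact Prod.ext (Prod.ext heq (h₁.1.2.1.symm.trans h₂.1.2.1)) (h₁.1.2.2.symm.trans h₂.1.2.2)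
      have hreal : ((((Finset.univ : Finset (Fin (sectorCount J'))).filter (fun ω : Fin (sectorCount J') =>
            Function.update ρ ℓ ((ω, (σ' ℓ).1.2), (σ' ℓ).2) ∈ bgmSectorSet L M (klAnisoFamily L M β μ K klE0 J') (m + 1))).card : ℕ) : ℝ)
            ≤ ⌈D⌉₊ := (hlast ρ ℓ (σ' ℓ).1.2 (σ' ℓ).2).trans (Nat.le_ceil D)
      exact hinj.trans (by exact_mod_cast hreal)
    have h := card_filter_prescribed_children_lastLeg_le
      (fun (ℓ'' : SectorLeg (sectorCount J')) (ℓ' : SectorLeg (sectorCount k)) =>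
        (∃ q : FreqMomentum L M, klAnisoFamily L M β μ K klE0 J' ℓ''.1.1 q ≠ 0 ∧
          bgmFatMultiplier L M klE0 β (nambuXiCT L μ K) k ℓ'.1.1 q ≠ 0) ∧
        ℓ'.1.2 = ℓ''.1.2 ∧ ℓ'.2 = ℓ''.2)
      (fun ℓ' => by convert hκ ℓ' using 2) A'' E τ'' σ' hℓ (D := ⌈D⌉₊) (fun ρ => by convert hDceil ρ using 2)
    have h' : ((A''.filter fun σ'' => (∀ e ∈ E, σ'' e = τ'' e) ∧ ∀ i,
        (∃ q : FreqMomentum L M, klAnisoFamily L M β μ K klE0 J' (σ'' i).1.1 q ≠ 0 ∧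
          bgmFatMultiplier L M klE0 β (nambuXiCT L μ K) k (σ' i).1.1 q ≠ 0) ∧
        (σ' i).1.2 = (σ'' i).1.2 ∧ (σ' i).2 = (σ'' i).2).card) ≤ ⌈D⌉₊ * (27 * 2 ^ (J' - k)) ^ ((m + 1) - E.card - 1) := by
      convert h using 2
    have h'r : (((A''.filter fun σ'' => (∀ e ∈ E, σ'' e = τ'' e) ∧ ∀ i,
        (∃ q : FreqMomentum L M, klAnisoFamily L M β μ K klE0 J' (σ'' i).1.1 q ≠ 0 ∧
          bgmFatMultiplier L M klE0 β (nambuXiCT L μ K) k (σ' i).1.1 q ≠ 0) ∧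
        (σ' i).1.2 = (σ'' i).1.2 ∧ (σ' i).2 = (σ'' i).2).card : ℝ)) ≤
        (⌈D⌉₊ : ℝ) * ((27 * 2 ^ (J' - k) : ℕ) : ℝ) ^ ((m + 1) - E.card - 1) := by exact_mod_cast h'
    have hceil : (⌈D⌉₊ : ℝ) ≤ D + 1 := (Nat.ceil_lt_add_one hD.le).le
    exact h'r.trans (mul_le_mul_of_nonneg_right hceil hXpos.le)

/-- **Pinned-leg form** — exactly the `R` / `hRoff` / `hRon` shape of k3c2-p3's `hubbardSectorKernelNorm_klAniso_jump_le_of_relCount[_split]`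
(one leg `p` pinned to a fine label `ℓ″`, nothing else prescribed): the count is `≤ D · (27·2^{J′−k})^{m − 1}` — of the `m` free legs, `m − 1` pay the
children count and the last one is determined. [cite: BenfattoGiulianiMastropietro2006, §2.8 (2.83), (2.89), App. A3] -/
theorem card_relCount_pinned_lastLeg_klAniso_le :
    ∀ μ₁ μ₂ : ℝ, -4 < μ₁ → μ₁ ≤ μ₂ → μ₂ < 0 → ∀ m : ℕ, ∃ D : ℝ, 0 < D ∧ ∀ R : RenConsts, (∀ j, 0 ≤ R.Gfr j) →
      ∃ c₃ : ℝ, 0 < c₃ ∧ ∃ U₀ : ℝ, 0 < U₀ ∧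
      ∀ c : ℝ, 0 < c → c ≤ c₃ → ∀ U : ℝ, 0 < U → U ≤ U₀ → ∀ β : ℝ, klBetaMin ≤ β → β ≤ Real.exp (c / U ^ 2) →
      ∀ μ ∈ Set.Icc μ₁ μ₂, ∀ (ν : ℝ) (K : TrigPolyC4v), FrameOK R U (nScales β) ν K →
      ∀ (L M : ℕ) [NeZero L] (k J' : ℕ), k ≤ J' →
      ∀ A'' : Finset (Fin (m + 1) → SectorLeg (sectorCount J')), A'' ⊆ bgmSectorSet L M (klAnisoFamily L M β μ K klE0 J') (m + 1) →
      ∀ (σ' : Fin (m + 1) → SectorLeg (sectorCount k)) (p : Fin (m + 1)) (ℓ'' : SectorLeg (sectorCount J')),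
      (((A''.filter fun σ'' => σ'' p = ℓ'' ∧ ∀ i,
        (∃ q : FreqMomentum L M, klAnisoFamily L M β μ K klE0 J' (σ'' i).1.1 q ≠ 0 ∧
          bgmFatMultiplier L M klE0 β (nambuXiCT L μ K) k (σ' i).1.1 q ≠ 0) ∧
        (σ' i).1.2 = (σ'' i).1.2 ∧ (σ' i).2 = (σ'' i).2).card : ℝ)) ≤
        D * ((27 * 2 ^ (J' - k) : ℕ) : ℝ) ^ (m - 1) := by
  intro μ₁ μ₂ hμ₁ h12 hμ₂ m
  obtain ⟨D, hD, hreg⟩ := card_relCount_prescribed_lastLeg_klAniso_le μ₁ μ₂ hμ₁ h12 hμ₂ m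
  refine ⟨D, hD, fun R hR => ?_⟩
  obtain ⟨c₃, hc₃, U₀, hU₀, hcnt⟩ := hreg R hR
  refine ⟨c₃, hc₃, U₀, hU₀, ?_⟩
  intro c hc hcle U hU hUle β hβmin hβc μ hμ ν K hK L M _ k J' hkJ A'' hA'' σ' p ℓ''
  have h := hcnt c hc hcle U hU hUle β hβmin hβc μ hμ ν K hK L M k J' hkJ A'' hA'' {p} (fun _ => ℓ'') σ'
  have hfilt : (A''.filter fun σ'' => σ'' p = ℓ'' ∧ ∀ i,
        (∃ q : FreqMomentum L M, klAnisoFamily L M β μ K klE0 J' (σ'' i).1.1 q ≠ 0 ∧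
          bgmFatMultiplier L M klE0 β (nambuXiCT L μ K) k (σ' i).1.1 q ≠ 0) ∧
        (σ' i).1.2 = (σ'' i).1.2 ∧ (σ' i).2 = (σ'' i).2) =
      (A''.filter fun σ'' => (∀ e ∈ ({p} : Finset (Fin (m + 1))), σ'' e = (fun _ : Fin (m + 1) => ℓ'') e) ∧ ∀ i,
        (∃ q : FreqMomentum L M, klAnisoFamily L M β μ K klE0 J' (σ'' i).1.1 q ≠ 0 ∧
          bgmFatMultiplier L M klE0 β (nambuXiCT L μ K) k (σ' i).1.1 q ≠ 0) ∧
        (σ' i).1.2 = (σ'' i).1.2 ∧ (σ' i).2 = (σ'' i).2) :=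
    Finset.filter_congr fun σ'' _ => by simp only [Finset.mem_singleton, forall_eq]
  have hexp : (m + 1) - ({p} : Finset (Fin (m + 1))).card - 1 = m - 1 := by rw [Finset.card_singleton]; omega
  rw [hfilt, ← hexp]
  exact h

/-- **The same on the covariance window `klWindowC`.** [cite: BenfattoGiulianiMastropietro2006, §2.8 (2.83), (2.88)-(2.90), App. A3] -/
theorem card_relCount_prescribed_lastLeg_klAniso_le_window :
    ∀ m : ℕ, ∃ D : ℝ, 0 < D ∧ ∀ R : RenConsts, (∀ j, 0 ≤ R.Gfr j) →
      ∃ c₃ : ℝ, 0 < c₃ ∧ ∃ U₀ : ℝ, 0 < U₀ ∧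
      ∀ c : ℝ, 0 < c → c ≤ c₃ → ∀ U : ℝ, 0 < U → U ≤ U₀ → ∀ β : ℝ, klBetaMin ≤ β → β ≤ Real.exp (c / U ^ 2) →
      ∀ μ ∈ klWindowC, ∀ (ν : ℝ) (K : TrigPolyC4v), FrameOK R U (nScales β) ν K →
      ∀ (L M : ℕ) [NeZero L] (k J' : ℕ), k ≤ J' →
      ∀ A'' : Finset (Fin (m + 1) → SectorLeg (sectorCount J')), A'' ⊆ bgmSectorSet L M (klAnisoFamily L M β μ K klE0 J') (m + 1) →
      ∀ (E : Finset (Fin (m + 1))) (τ'' : Fin (m + 1) → SectorLeg (sectorCount J')) (σ' : Fin (m + 1) → SectorLeg (sectorCount k)),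
      (((A''.filter fun σ'' => (∀ e ∈ E, σ'' e = τ'' e) ∧ ∀ i,
        (∃ q : FreqMomentum L M, klAnisoFamily L M β μ K klE0 J' (σ'' i).1.1 q ≠ 0 ∧
          bgmFatMultiplier L M klE0 β (nambuXiCT L μ K) k (σ' i).1.1 q ≠ 0) ∧
        (σ' i).1.2 = (σ'' i).1.2 ∧ (σ' i).2 = (σ'' i).2).card : ℝ)) ≤
        D * ((27 * 2 ^ (J' - k) : ℕ) : ℝ) ^ ((m + 1) - E.card - 1) :=
  card_relCount_prescribed_lastLeg_klAniso_le (-1.05) (-0.15) (by norm_num) (by norm_num) (by norm_num)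

end Summit.HubbardSuperconductivity.HubbardSuperconductivity.Theorems.EngineV8

end
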